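import Literature.NumberTheory.LFunctions.CentralValueFamilyLevelAvgTotal
import Literature.NumberTheory.LFunctions.KMVMollifiedMomentForms
import Literature.NumberTheory.LFunctions.SiegelTheorem
import Literature.NumberTheory.LFunctions.ExceptionalCharacterLacunarPrimes

/-!
# Route `PrimeLevelFamEdge` — TYPED IDEA DELTAS, deck 3: NEW FAMILIES for the edge (cell ls-idea;
card K-I2-3 «square levels neutralise the compatibility sign»; further second-wave cards append here)

PROOF-FREE data / `def … : Prop` deltas for idea cards that passed the cell's critics A/B/C, typed on
the tree's abstract `CentralValueFamily` vocabulary (`CentralValueFamilyHalfEdge.lean`,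
`CentralValueFamilyLevelAvgTotal.lean`); kernel lemmas only where one-liners. NOTHING IS ASSERTED;
«typed ≠ proved; no exceptional-zero theorem (no Landau–Siegel exclusion, no Theorem 1–2 of
arXiv:2211.02515, no repaired Margin232) is proved by ideation». Card texts / verdicts:
`run/shared/lean/pub/ls-idea/CARDS.md`, `cards/ls-idea-lens-2.md`, `ls-idea-ref-{1,2,3}/card-verdicts.md`.
-/

noncomputable section

namespace Summit.Parity.GeneralizedHardyLittlewood.Theorems.PrimeLevelFamEdgeIdeaDeltas

open Literature.NumberTheory.LFunctions
open Literature.NumberTheory.LFunctions.IwaniecSarnak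
open Literature.NumberTheory.LFunctions.CentralValueFamilyHalfEdge
open Literature.NumberTheory.EllipticCurves.ModularForms
open scoped Classical

/-- **K-I2-3 «SQUARE LEVELS NEUTRALISE THE COMPATIBILITY SIGN» (lens-2; critics A PASS · B PASS
(half-rung, even χ) · C PASS-with-FIX).** The family datum: `𝓗_k(p²)` — verbatim the tree's
`iwaniecSarnakFamily k` (levels `N ∈ ℕ⁺`, newforms `newforms0 N k`, harmonic weights, root number,
central values, compatibility `(N,D) = 1 ∧ χ(−N) = 1`) with ADMISSIBLE := «`N = p²`, `p` prime»
instead of «squarefree». Mechanism (card): `w(f)w(f ⊗ χ_D) = χ_D(−N)`, and at `N = p²`, `p ∤ D`,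
`χ_D(−p²) = χ_D(−1)` — for EVEN `χ_D` every prime-square level is compatible (for odd, none), so
Iwaniec–Sarnak's obstruction «restricting the level average to compatible levels loses the excess»
is void for the even half: one may average over `p ∈ (X, 2X]` keeping every level usable in the
endgame; the new variable it buys is the Salié-explicit Kloosterman sum at prime-square moduli
(roots of quadratic congruences to prime moduli, DFI/Tóth). RUNG: the EVEN-CHARACTER HALF of F-S3
via a level-averaged door. Controls: G-24 C4 (proportion currency) in level-averaged form. Falsifiers
(card): F2 density of prime squares vs the averaged gain; F3 kit «bed7-square-level». Oldforms at
level p² need Rouymi's formula (card (v)); the refuted-as-typed `PeterssonPrinted` warns that level-p²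
Petersson typing must carry oldform/Atkin–Lehner terms explicitly. A DATUM; nothing asserted.
[cite: IwaniecConversations2006, §7 (7.1)–(7.6) and p. 97 L13–L15] -/
abbrev squareLevelFamily (k : ℤ) : CentralValueFamily where
  Param := ℕ+
  size := fun N => ((N : ℕ) : ℝ)
  Admissible := fun N => ∃ p : ℕ, p.Prime ∧ (N : ℕ) = p ^ 2
  Form := fun N => CuspForm (CongruenceSubgroup.Gamma0 (N : ℕ)) k
  forms := fun N => (finite_newforms0_holds (N : ℕ) k).toFinset
  weight := fun _ f => harmonicWeight f
  Even := fun _ f => rootNumber f = 1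
  value := fun _ f => (centralValue f).re
  twistedValue := fun _ f {_} χ => (twistedCentralValue f χ).re
  Compatible := fun N {D} χ => (N : ℕ).Coprime D ∧ χ (-((N : ℕ) : ZMod D)) = 1

/-- **The sign bookkeeping (proved): at a prime-square level coprime to `D`, compatibility with a
quadratic `χ mod D` is exactly «`χ` even».** `χ(−p²) = χ(−1)·χ(p)² = χ(−1)` since `χ(p) = ±1` for
`p ∤ D`. [cite: IwaniecConversations2006, §7 (p0096:L27, w = χ(−N))] -/
theorem compatible_squareLevel_iff {k : ℤ} {N : ℕ+} {p : ℕ} (hN : (N : ℕ) = p ^ 2)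
    {D : ℕ} [NeZero D] {χ : DirichletCharacter ℂ D} (hquad : MulChar.IsQuadratic χ)
    (hcop : (N : ℕ).Coprime D) :
    (squareLevelFamily k).Compatible N χ ↔ χ (-1) = 1 := by
  show ((N : ℕ).Coprime D ∧ χ (-((N : ℕ) : ZMod D)) = 1) ↔ χ (-1) = 1
  have hpcop : p.Coprime D := (Nat.coprime_pow_left_iff (by norm_num : 0 < 2) p D).1 (hN ▸ hcop)
  have hu : IsUnit ((p : ℕ) : ZMod D) := (ZMod.isUnit_iff_coprime p D).2 hpcop
  have hχu : IsUnit (χ (p : ZMod D)) := hu.map χ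
  have hsq : χ (p : ZMod D) ^ 2 = 1 := by
    rcases hquad (p : ZMod D) with h0 | h1 | hm1
    · exact absurd h0 hχu.ne_zero
    · rw [h1]; norm_num
    · rw [hm1]; norm_num
  have hval : χ (-((N : ℕ) : ZMod D)) = χ (-1) := by
    rw [hN, Nat.cast_pow, show (-((p : ZMod D) ^ 2)) = (-1) * (p : ZMod D) ^ 2 by ring,
      map_mul, map_pow, hsq, mul_one]
  rw [hval]
  exact ⟨fun h => h.2, fun h => ⟨hcop, h⟩⟩

open scoped Classical in
/-- **The χ-free PRIME-SQUARE level window** at scale `X`: levels `N = p²` with `p` prime,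
`N ∈ [⌈X⌉, ⌊2X⌋]`, `(N, D) = 1` (no root-number condition — for even `χ_D` every such level is
compatible, `compatible_squareLevel_iff`). [cite: IwaniecConversations2006, §7 p. 97 L9–L15 (level averaging)] -/
def squareWindow (X : ℝ) (D : ℕ) (_χ : DirichletCharacter ℂ D) : Finset ℕ+ :=
  (Finset.Icc (Nat.toPNat' ⌈X⌉₊) (Nat.toPNat' ⌊2 * X⌋₊)).filter
    (fun N => (∃ p : ℕ, p.Prime ∧ (N : ℕ) = p ^ 2) ∧ (N : ℕ).Coprime D)

/-- **K-I2-3's door (even half of the rung): the level-AVERAGED (7.5)-edge over prime-square levels**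
at proportion `p₁` for the weight-2 family `squareLevelFamily 2`, uniformly in `D ≤ X^δ` — typed on
the tree's `EStarFamLevelAvg` over the χ-free `squareWindow` (the seat's typing hint). For EVEN real
`χ_D` the window is compatible level by level, so the §7 pigeonhole fires at some level of the window
(glue = the even-χ restriction of `CentralValueFamily.lOne_lowerBound_of_EStarFamLevelAvg_total` fed
with square-level twins of the printed shapes `EvenShareAvg` / `MixedOverTotalMassAvg` / `TwistedHalfAvg`
— none typed at level p² (oldforms via Rouymi): CLAIMED, S/M-sized; conclusion = `L(1,χ_D) ≥ c(log D)⁻⁴`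
for EVEN real primitive `χ_D` only, a HALF-RUNG per critics A/B). `p₁ > ½` is the open content.
A PREDICATE; nothing asserted; typed ≠ proved. [cite: IwaniecConversations2006, §7 (7.5) and p. 97 L13–L15] -/
def SquareLevelEdge (p₁ δ : ℝ) : Prop :=
  (squareLevelFamily 2).EStarFamLevelAvg squareWindow p₁ 2 δ

/-! ## §2 K-I8-8 «ILLUSORY PRIMES AS LEVELS» — the (A)-structured LEVEL SET and its two typed
inputs (lens-8 gen 2, third wave; critics A PASS as STRUCTURE/INSTRUMENT of record (the clause `K1_κ` was
STRUCK by B (W-COH) and withdrawn by the author; repair v0.7.1 accepted by A/B; C batch 17). Typed here: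
ONLY the two character-sum INPUT shapes of the author's `Sketch_ThirdWave.lean` (rc 0), parametrised by
their constants; the owned crux `X_k` («P_k-level-averaged edge», ¬(A)_k-strength) is the tree's
`CentralValueFamily.EStarFamLevelAvg` over the card's window and is NOT re-typed. -/

/-- K-I8-8 / annex A-I8-4: the character-twisted, `m^{−1/2}`-weighted Möbius sum
`Σ_{m ≤ M} μ(m) ψ(m) m^{−1/2}` (mollifier weight `P ≡ 1`) — the generic-branch resonance `R_ψ(M)` of the
route's PIN P-circ at `P ≡ 1`. A DEFINITION (lens-8 `muTwistSum`).
[cite: IwaniecConversations2006, §8 (8.2)] -/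
def muTwistSum (q' : ℕ) (ψ : DirichletCharacter ℂ q') (M : ℝ) : ℂ :=
  ∑ m ∈ Finset.Icc 1 ⌊M⌋₊,
    ((ArithmeticFunction.moebius m : ℤ) : ℂ) * ψ (m : ZMod q') * ((m : ℂ) ^ (-(1 / 2 : ℂ)))

/-- **Annex A-I8-4 «ONE ELEMENTARY LEMMA» (shape, NOT proved; constant `C` a parameter).** For an
integer `r ≥ 2`: for every real primitive `χ mod D`, every `q'` coprime to `D`, every character
`ψ mod q'` and every `M ≥ D²·(q'D)^{1/4 + 1/(2r)}`,
`‖Σ_{m≤M} μ(m)ψ(m)m^{−1/2}‖ ≤ C·√M·(L(1,χ)·log M + (q'D)^{−1/(4r²)}·(log D)²)`. Mechanism (card):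
`μ = ν ∗ χ_D` exactly, Burgess on the `χ_Dψ`-sums of length `≥ (q'D)^{1/4+1/(2r)}`, Iwaniec (8.2) on
the lacunary tail `Σ_{a > A₀} λ(a)/a`; unconditional in form, useful only when `L(1,χ_D)` is small
(shape of Drappeau–Maynard 2019 Thm 1.1 / Friedlander–Iwaniec 2003 Thm 3.1, tree
`friedlanderIwaniec2003_theorem31`). A PREDICATE in `(r, C)`; nothing asserted; typed ≠ proved.
[cite: IwaniecConversations2006, §8 (8.2)] [cite: FriedlanderIwaniec2003ExceptionalAP, Thm. 3.1] -/
def MuTwistBoundSmallL1 (r : ℕ) (C : ℝ) : Prop :=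
  ∀ (D : ℕ) [NeZero D] (χ : DirichletCharacter ℂ D), χ.IsPrimitive → MulChar.IsQuadratic χ →
    ∀ (q' : ℕ) [NeZero q'] (ψ : DirichletCharacter ℂ q'), Nat.Coprime q' D →
      ∀ M : ℝ, (D : ℝ) ^ 2 * ((q' : ℝ) * D) ^ ((1 : ℝ) / 4 + 1 / (2 * r)) ≤ M →
        ‖muTwistSum q' ψ M‖ ≤
          C * Real.sqrt M *
            ((χ.LFunction 1).re * Real.log M +
              ((q' : ℝ) * D) ^ (-(1 : ℝ) / (4 * (r : ℝ) ^ 2)) * (Real.log D) ^ 2)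

/-- **K-I8-8, input K4 «FEW SPLIT PRIMES WHEN `L(1,χ)` IS SMALL» (shape in Iwaniec's (8.5)-form, NOT
proved; constant `C` a parameter).** For every real primitive `χ mod D` and every `Y ≥ D²`,
`#{p prime : Y ≤ p ≤ 2Y, χ(p) = 1} ≤ C · L(1,χ) · Y · log Y` — from (8.5)
`Σ_{z ≤ p < x} λ(p)/p ≤ L(1,χ)[log x + O(log z)]` (`λ = 1 ∗ χ`, `x > z ≥ D²`): under (A) almost all
primes in `[D², D^{A}]` are INERT, so prime LEVELS there are «auto-compatible» for the parity with
`χ_D(−1)(−1) = +1` — the card's structuring of the LEVEL SET by (A) (A re-derived the count; the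
incompatible mass fraction `≪ (kδ)^{−2}(log D)^{−ε}` in branch two). A PREDICATE in `C`; nothing
asserted; typed ≠ proved. [cite: IwaniecConversations2006, §8 (8.5) p. 98] -/
def SplitPrimeCountSmallL1 (C : ℝ) : Prop :=
  ∀ (D : ℕ) [NeZero D] (χ : DirichletCharacter ℂ D), χ.IsPrimitive → MulChar.IsQuadratic χ →
    ∀ Y : ℝ, (D : ℝ) ^ 2 ≤ Y →
      ((((Finset.Icc ⌈Y⌉₊ ⌊2 * Y⌋₊).filter
          fun p : ℕ => p.Prime ∧ χ ((p : ℕ) : ZMod D) = 1).card : ℕ) : ℝ) ≤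
        C * (χ.LFunction 1).re * Y * Real.log Y

/-- Bookkeeping (proved): the split-prime count shape is monotone in its constant (for `Y ≥ 1` and
`L(1,χ) ≥ 0`, which the shape's users supply; stated with both as hypotheses on the instance).
[cite: IwaniecConversations2006, §8 (8.5) p. 98] -/
theorem SplitPrimeCountSmallL1.mono {C C' : ℝ} (h : SplitPrimeCountSmallL1 C) (hCC : C ≤ C')
    (hL : ∀ (D : ℕ) [NeZero D] (χ : DirichletCharacter ℂ D), χ.IsPrimitive → MulChar.IsQuadratic χ →
      0 ≤ (χ.LFunction 1).re) :
    SplitPrimeCountSmallL1 C' := by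
  intro D _ χ hprim hquad Y hY
  refine (h D χ hprim hquad Y hY).trans ?_
  have hD1 : (1 : ℝ) ≤ (D : ℝ) := by exact_mod_cast Nat.one_le_iff_ne_zero.mpr (NeZero.ne D)
  have hY1 : 1 ≤ Y := le_trans (by nlinarith) hY
  have hlog : 0 ≤ Real.log Y := Real.log_nonneg hY1
  have h0 : 0 ≤ (χ.LFunction 1).re * Y * Real.log Y :=
    mul_nonneg (mul_nonneg (hL D χ hprim hquad) (by linarith)) hlog
  nlinarith

/-! ## §3 K-I1-8 ★ «FS-PINCER LAW» — the two-jaw CONSERVATION LAW as arithmetic (lens-1 gen 3 §10;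
critic B PASS ★ STRUCTURE/NO-GO LAW (batch 20, locators byte-checked); the same identity is lens-2
K-I2-4 (B)'s conservation law `u + v ≥ 2 log D/log N` and lens-6 K6-8's «the debt is D²», A re-derived).
The card's law: in every self-dual family where positivity (P) and a mollified pincer (M) hold, each jaw
obeys `p_i ≤ Δ_i/(1+Δ_i)` (KMV Thm 6.1: the even-class optimum `2·envelope Δ_i`) with `Δ_i ≤ 1` at the
family's own sign-separated diagonal, so the excess `p₁ + p₂ − 1 > 0` that the edge theorem consumes can
ONLY be bought beyond a diagonal. PROVED here: the exact two-jaw arithmetic on the tree's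
`KMV2000.envelope Δ = Δ/(2(1+Δ))`; the (P)/(M) premises and the family catalogue are the card's, not
asserted. -/

/-- **K-I1-8 ★ / K-I2-4 (B): the CONSERVATION LAW of two KMV jaws (proved arithmetic).** For
`Δ₁, Δ₂ > 0` the even-class optimal proportions `p_i = Δ_i/(1+Δ_i) = 2·envelope Δ_i` satisfy
`p₁ + p₂ > 1 ⟺ Δ₁·Δ₂ > 1` — so with both mollifiers at or inside their diagonals (`Δ_i ≤ 1`) no positive
pincer excess exists, and to first order the widths `u = Δ₁ − 1`, `v = Δ₂ − 1` beyond the two diagonals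
must satisfy `u + v > 0` (lens-2's `u + v ≥ 2 log D/log N` once the twisted diagonal `√N/D` is booked).
[cite: KowalskiMichelVanderKam2000, Thm. 6.1 (32)] [cite: IwaniecConversations2006, §7 (7.5)–(7.7) and p. 97 L15] -/
theorem pincer_sum_gt_one_iff {Δ₁ Δ₂ : ℝ} (h₁ : 0 < Δ₁) (h₂ : 0 < Δ₂) :
    1 < 2 * KMV2000.envelope Δ₁ + 2 * KMV2000.envelope Δ₂ ↔ 1 < Δ₁ * Δ₂ := by
  unfold KMV2000.envelope
  have e₁ : 2 * (Δ₁ / (2 * (1 + Δ₁))) = Δ₁ / (1 + Δ₁) := by field_simp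
  have e₂ : 2 * (Δ₂ / (2 * (1 + Δ₂))) = Δ₂ / (1 + Δ₂) := by field_simp
  rw [e₁, e₂]
  have hp : 0 < (1 + Δ₁) * (1 + Δ₂) := by positivity
  have key : Δ₁ / (1 + Δ₁) + Δ₂ / (1 + Δ₂) = (Δ₁ * (1 + Δ₂) + Δ₂ * (1 + Δ₁)) / ((1 + Δ₁) * (1 + Δ₂)) := by
    field_simp
  rw [key, lt_div_iff₀ hp]
  constructor <;> intro h <;> nlinarith

/-- **K-I1-8 ★ NO-GO at the diagonals (proved arithmetic):** two jaws with `0 < Δ_i ≤ 1` (both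
mollifiers at or inside their sign-separated diagonals) have `p₁ + p₂ ≤ 1` — the excess the edge theorem
`CentralValueFamily.lOne_lowerBound_of_EStarFam` needs is unavailable on the diagonals in ANY self-dual
enlargement (the card's corollary «no enlargement changes the NEEDED cell of G-24 C4′»).
[cite: KowalskiMichelVanderKam2000, Thm. 6.1 (32)] -/
theorem pincer_sum_le_one_of_le_one {Δ₁ Δ₂ : ℝ} (h₁ : 0 < Δ₁) (h₂ : 0 < Δ₂) (hΔ₁ : Δ₁ ≤ 1)
    (hΔ₂ : Δ₂ ≤ 1) : 2 * KMV2000.envelope Δ₁ + 2 * KMV2000.envelope Δ₂ ≤ 1 := by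
  by_contra h
  have h' : 1 < 2 * KMV2000.envelope Δ₁ + 2 * KMV2000.envelope Δ₂ := lt_of_not_ge h
  have := (pincer_sum_gt_one_iff h₁ h₂).1 h'
  nlinarith

/-- **K-I1-8 ★ with the twisted DEFICIT (proved arithmetic):** if the twisted jaw only reaches
`p₂ = 2·envelope Δ₂ − d` (deficit `d ≥ 0`, lens-6 §3 / lens-2 (C): `d ≍ log D/log √Q`), then at the
diagonals `p₁ + p₂ ≤ 1 − d`: the pincer closes only with an off-diagonal excess `> d`.
[cite: KowalskiMichelVanderKam2000, Thm. 6.1 (32)] [cite: IwaniecConversations2006, §7 (7.6)] -/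
theorem pincer_sum_le_one_sub_deficit {Δ₁ Δ₂ d : ℝ} (h₁ : 0 < Δ₁) (h₂ : 0 < Δ₂) (hΔ₁ : Δ₁ ≤ 1)
    (hΔ₂ : Δ₂ ≤ 1) : 2 * KMV2000.envelope Δ₁ + (2 * KMV2000.envelope Δ₂ - d) ≤ 1 - d := by
  have := pincer_sum_le_one_of_le_one h₁ h₂ hΔ₁ hΔ₂
  linarith

/-! ## §2′ K-I8-8 inputs — CORRECTED SHAPES (typer's erratum to §2, same session): the §2 predicates
`MuTwistBoundSmallL1 r C` and `SplitPrimeCountSmallL1 C` quantify over ALL primitive «quadratic»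
characters, which in `MulChar.IsQuadratic`'s sense includes the TRIVIAL character mod 1; there
`χ.LFunction 1 = riemannZeta 1` is Mathlib's junk value `(γ − log 4π)/2 < 0`, which makes both §2
shapes FALSE for every parameter (refutable-as-typed; junk-value smell, CONVENTIONS §4). The corrected
shapes below add the guard `χ ≠ 1` (for `D ≥ 2` a primitive character is never trivial, so only the
degenerate instance is removed; then `L(1,χ) > 0` by the tree's `Siegel.LFunction_one_re_pos`). The §2
names are DEPRECATED in favour of these (append-only protocol: deprecate, don't mutate). -/

/-- **Annex A-I8-4 «ONE ELEMENTARY LEMMA», corrected shape (guard `χ ≠ 1`; NOT proved; constant `C` a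
parameter).** For an integer `r ≥ 2`: for every NONTRIVIAL real primitive `χ mod D`, every `q'` coprime
to `D`, every character `ψ mod q'` and every `M ≥ D²·(q'D)^{1/4 + 1/(2r)}`,
`‖Σ_{m≤M} μ(m)ψ(m)m^{−1/2}‖ ≤ C·√M·(L(1,χ)·log M + (q'D)^{−1/(4r²)}·(log D)²)`. Mechanism as in §2
(`μ = ν ∗ χ_D`, Burgess, Iwaniec (8.2)); useful only when `L(1,χ_D)` is small. A PREDICATE in `(r, C)`;
nothing asserted; typed ≠ proved. [cite: IwaniecConversations2006, §8 (8.2)]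
[cite: FriedlanderIwaniec2003ExceptionalAP, Thm. 3.1] -/
def MuTwistBoundSmallL1Nontrivial (r : ℕ) (C : ℝ) : Prop :=
  ∀ (D : ℕ) [NeZero D] (χ : DirichletCharacter ℂ D), χ ≠ 1 → χ.IsPrimitive → MulChar.IsQuadratic χ →
    ∀ (q' : ℕ) [NeZero q'] (ψ : DirichletCharacter ℂ q'), Nat.Coprime q' D →
      ∀ M : ℝ, (D : ℝ) ^ 2 * ((q' : ℝ) * D) ^ ((1 : ℝ) / 4 + 1 / (2 * r)) ≤ M →
        ‖muTwistSum q' ψ M‖ ≤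
          C * Real.sqrt M *
            ((χ.LFunction 1).re * Real.log M +
              ((q' : ℝ) * D) ^ (-(1 : ℝ) / (4 * (r : ℝ) ^ 2)) * (Real.log D) ^ 2)

/-- **K-I8-8, input K4 «FEW SPLIT PRIMES WHEN `L(1,χ)` IS SMALL», corrected shape (guard `χ ≠ 1`;
Iwaniec's (8.5)-form; NOT proved; constant `C` a parameter).** For every NONTRIVIAL real primitive
`χ mod D` and every `Y ≥ D²`, `#{p prime : Y ≤ p ≤ 2Y, χ(p) = 1} ≤ C · L(1,χ) · Y · log Y` — from (8.5)
`Σ_{z ≤ p < x} λ(p)/p ≤ L(1,χ)[log x + O(log z)]`, `x > z ≥ D²`, implied constant absolute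
(Conversations p. 98: «χ(p) = −1 for almost all p in the range D² ≤ p ≤ D^A … provided χ is
exceptional»). A PREDICATE in `C`; nothing asserted; typed ≠ proved.
[cite: IwaniecConversations2006, §8 (8.5) p. 98] -/
def SplitPrimeCountSmallL1Nontrivial (C : ℝ) : Prop :=
  ∀ (D : ℕ) [NeZero D] (χ : DirichletCharacter ℂ D), χ ≠ 1 → χ.IsPrimitive → MulChar.IsQuadratic χ →
    ∀ Y : ℝ, (D : ℝ) ^ 2 ≤ Y →
      ((((Finset.Icc ⌈Y⌉₊ ⌊2 * Y⌋₊).filter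
          fun p : ℕ => p.Prime ∧ χ ((p : ℕ) : ZMod D) = 1).card : ℕ) : ℝ) ≤
        C * (χ.LFunction 1).re * Y * Real.log Y

/-- Bookkeeping (proved): the corrected split-prime count shape is monotone in its constant — here with
NO positivity hypothesis, since `L(1,χ) > 0` for nontrivial quadratic `χ` is the tree's
`Siegel.LFunction_one_re_pos` (`χ² = 1` from `MulChar.IsQuadratic.sq_eq_one`).
[cite: IwaniecConversations2006, §8 (8.5) p. 98] [cite: MontgomeryVaughan2007, §4.3 p. 102] -/
theorem SplitPrimeCountSmallL1Nontrivial.mono {C C' : ℝ} (h : SplitPrimeCountSmallL1Nontrivial C)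
    (hCC : C ≤ C') : SplitPrimeCountSmallL1Nontrivial C' := by
  intro D _ χ hne hprim hquad Y hY
  refine (h D χ hne hprim hquad Y hY).trans ?_
  have hD1 : (1 : ℝ) ≤ (D : ℝ) := by exact_mod_cast Nat.one_le_iff_ne_zero.mpr (NeZero.ne D)
  have hY1 : 1 ≤ Y := le_trans (by nlinarith) hY
  have hlog : 0 ≤ Real.log Y := Real.log_nonneg hY1
  have hL : 0 ≤ (χ.LFunction 1).re :=
    (Siegel.LFunction_one_re_pos χ hne hquad.sq_eq_one).le
  have h0 : 0 ≤ (χ.LFunction 1).re * Y * Real.log Y :=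
    mul_nonneg (mul_nonneg hL (by linarith)) hlog
  nlinarith

/-- The unguarded §2 shape implies the corrected one (so nothing typed against §2 is lost).
[cite: IwaniecConversations2006, §8 (8.2)] -/
theorem muTwistBoundSmallL1Nontrivial_of_unguarded {r : ℕ} {C : ℝ} (h : MuTwistBoundSmallL1 r C) :
    MuTwistBoundSmallL1Nontrivial r C :=
  fun D _ χ _ hprim hquad q' _ ψ hcop M hM ↦ h D χ hprim hquad q' ψ hcop M hM

/-- The unguarded §2 shape implies the corrected one. [cite: IwaniecConversations2006, §8 (8.5) p. 98] -/
theorem splitPrimeCountSmallL1Nontrivial_of_unguarded {C : ℝ} (h : SplitPrimeCountSmallL1 C) :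
    SplitPrimeCountSmallL1Nontrivial C :=
  fun D _ χ _ hprim hquad Y hY ↦ h D χ hprim hquad Y hY

attribute [deprecated MuTwistBoundSmallL1Nontrivial (since := "2026-08-27")] MuTwistBoundSmallL1
attribute [deprecated SplitPrimeCountSmallL1Nontrivial (since := "2026-08-27")] SplitPrimeCountSmallL1
attribute [deprecated SplitPrimeCountSmallL1Nontrivial.mono (since := "2026-08-27")]
  SplitPrimeCountSmallL1.mono

/-! ## §2″ K-I8-8 input K4 DERIVED FROM PRINT (typer gen 1): the corrected shape
`SplitPrimeCountSmallL1Nontrivial C` holds for SOME absolute `C` as soon as Iwaniec's printed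
inequality (8.5) does — Literature `iwaniec2006_eq85` (named fact, Conversations §8 p. 98) and its
PROVED corollary `splitPrimeCount_le_of_eq85` (`ExceptionalCharacterLacunarPrimes.lean`). -/

/-- **K4 ⇐ (8.5) (kernel glue, proved):** Iwaniec's (8.5) gives the split-prime count shape
`SplitPrimeCountSmallL1Nontrivial C` for some absolute `C` (`= 2 + max(c, 0)`, `c` the constant of
(8.5)). So card K-I8-8's input K4 is printed-modulo-(8.5), an elementary named fact, and no longer a
card-specific hypothesis. [cite: IwaniecConversations2006, §8 (8.5) p. 98] -/
theorem splitPrimeCountSmallL1Nontrivial_of_eq85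
    (h : Literature.NumberTheory.LFunctions.iwaniec2006_eq85) :
    ∃ C : ℝ, SplitPrimeCountSmallL1Nontrivial C :=
  Literature.NumberTheory.LFunctions.splitPrimeCount_le_of_eq85 h

/-! ## §2‴ Annex A-I8-5 «SECOND DIAL + HARMONIC CONFINEMENT» (lens-8 gen 4, sketch
`Sketch_HarmonicConfinement.lean` sha16 29bbc4b42656c5c0; referee A batch 29 KEEP annex-level precision
«a genuine sharpening of (8.5)», referee B batch 31 «(R1) to be PROVED from a named fact for MV
Ex. 11.2.1.3(g), never its own fact»). The printed input is the Literature named fact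
`montgomeryVaughan2007_ex11_2_1_3g` (`QuadraticCharacterDivisorSumHarmonic.lean`); here the two
consumer SHAPES, parametrised by their constants, NOT asserted (their derivation from (g) — positivity
of `r = 1 ∗ χ`, `k`-fold products of split primes, `k = ⌈1/(2t)⌉ + 1` — is the annex's, ≈ 150–250
lines, not carried out). -/

/-- **(R1) sub-`D²` HARMONIC CONFINEMENT of the split primes (annex A-I8-5), parametric shape.** At
exponents `0 < t < C` with constant `K`: for every nontrivial real primitive `χ mod D` in the
(A)_{3/2}-world `L(1,χ)·(log D)^{3/2} ≤ 1`, `Σ_{p prime, D^t ≤ p ≤ D^C, χ(p)=1} 1/p ≤ K·(log D)^{−t/(1+4t)}`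
— Iwaniec's (8.5) pushed below `D²` by Pólya–Vinogradov (MV Ex. 11.2.1.3(g)). The annex's claim is
`∀ t C, 0 < t < C → ∃ K, SplitHarmonicMassConfined t C K`; typed ≠ proved.
[cite: MontgomeryVaughan2007, §11.2.1 Exercise 3(g) p. 286] [cite: IwaniecConversations2006, §8 (8.5)] -/
def SplitHarmonicMassConfined (t C K : ℝ) : Prop :=
  ∀ (D : ℕ) [NeZero D] (χ : DirichletCharacter ℂ D), χ ≠ 1 → χ.IsPrimitive →
    MulChar.IsQuadratic χ → (χ.LFunction 1).re * Real.log (D : ℝ) ^ (3 / 2 : ℝ) ≤ 1 →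
      (∑ p ∈ (Finset.Icc ⌈(D : ℝ) ^ t⌉₊ ⌊(D : ℝ) ^ C⌋₊).filter
          (fun p : ℕ => p.Prime ∧ χ ((p : ℕ) : ZMod D) = 1), 1 / (p : ℝ)) ≤
        K * Real.log (D : ℝ) ^ (-(t / (1 + 4 * t)))

/-- **A-I8-5 consequence (i) «`Σ_{split p ≤ D} log p/p = o(log D)` in the (A)_{3/2}-world», parametric
shape** (the `C = 1` instance of (R1) integrated against `log p ≤ log D` on `[D^t, D]` plus Mertens
below `D^t`; consumer: K5-8's second-dial corrections `≤ d·o(1)`). At tolerance `ε` beyond `D₀`.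
A PREDICATE in `(ε, D₀)`; nothing asserted. [cite: MontgomeryVaughan2007, §11.2.1 Exercise 3(g) p. 286] -/
def SplitLogMassSmall (ε : ℝ) (D₀ : ℕ) : Prop :=
  ∀ (D : ℕ) [NeZero D] (χ : DirichletCharacter ℂ D), D₀ ≤ D → χ ≠ 1 → χ.IsPrimitive →
    MulChar.IsQuadratic χ → (χ.LFunction 1).re * Real.log (D : ℝ) ^ (3 / 2 : ℝ) ≤ 1 →
      (∑ p ∈ (Finset.Icc 1 D).filter (fun p : ℕ => p.Prime ∧ χ ((p : ℕ) : ZMod D) = 1),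
          Real.log (p : ℝ) / (p : ℝ)) ≤ ε * Real.log (D : ℝ)

/-- Bookkeeping (proved): (R1) is monotone in its constant. [cite: MontgomeryVaughan2007, §11.2.1 Exercise 3(g) p. 286] -/
theorem SplitHarmonicMassConfined.mono {t C K K' : ℝ} (h : SplitHarmonicMassConfined t C K)
    (hKK : K ≤ K') : SplitHarmonicMassConfined t C K' := by
  intro D _ χ hne hprim hquad hA
  refine (h D χ hne hprim hquad hA).trans ?_
  exact mul_le_mul_of_nonneg_right hKK (Real.rpow_nonneg (Real.log_natCast_nonneg D) _)

end Summit.Parity.GeneralizedHardyLittlewood.Theorems.PrimeLevelFamEdgeIdeaDeltas
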